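import Literature.MathematicalPhysics.QuantumFieldTheory.TomboulisYaffeLoopBounds
import Literature.MathematicalPhysics.QuantumFieldTheory.TorusWilsonLoopRepGramBounds
import HarnessLib

/-!
# Crux `IR` (stmt-QuantumFields-19354), line `tension-ratio` (flux skeleton), stub `TYObservable` — part 2:
# Tomboulis–Yaffe doubling and axis exchange for Polyakov-loop correlators in an OBSERVABLE representation

Pooled prover `ym-ir-line-pool-p3` (gen 3).  Helper module for item `stmt-QuantumFields-19354` (`--supports`; it closes
nothing).  The tree file `Literature/…/TomboulisYaffeLoopBounds.lean` proves the first links of the Tomboulis–Yaffe chain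
(App. I (A1.3)–(A1.7)) for loops taken in the SAME representation `ρ` as the Wilson action.  The flux skeleton of line
`ym-ir7-tension-ratio` (`Cruxes/IR/Lines/ym_ir7_tension_ratio_flux.lean`, stub `TYObservable`) needs them for loops in an arbitrary
continuous PROBE representation `π : G →* M_M(ℂ)` under the Wilson measure of `ρ`; reflection positivity is a property of the
MEASURE, so the proofs are the tree's, with the observable unitarised through `CompactGroup.unitarize π` and the Gram
inequality of `TorusWilsonLoopRepGramBounds` (`gram_wilsonLoopRep_nonneg_even`, p592927) for the first doubling:

* `wilsonLoopRep_sq_le_double` — `⟨W^π_{h×w}⟩² ≤ ⟨W^π_{2h×w}⟩`, `0 ≤ ⟨W^π_{2h×w}⟩` (`h ≤ L/2`);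
* `wilsonLoopRep_half_sq_le_polyakovCorrelator` — `⟨W^π_{(L/2)×w}⟩² ≤ Re ⟨tr π(Π₀(0)) conj tr π(Π₀(w eⱼ))⟩`;
* `polyakovCorrelatorRep_normSq_le_double` — `|⟨tr π(Πⱼ(0)) conj tr π(Πⱼ(s e₀))⟩|² ≤ M² Re ⟨… (2s e₀)⟩ ≥ 0` (`s ≤ L/2`);
* `polyakovCorrelatorRep_swap` — exchange of the axes `0 ↔ j`.

Torus `(ℤ/L)ᵈ`, `L` even, any real `β`, compact `G`, continuous `ρ`, `π`.  Everything is proved; no new definitions; nothing here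
bears on the Yang–Mills mass gap.  [cite: TomboulisYaffe1985, App. I (A1.3)–(A1.7)]
-/

open MeasureTheory Finset Complex
open scoped ComplexOrder ComplexConjugate

noncomputable section

namespace Summit.QuantumFields.YangMills.Cruxes.IR.TensionRatio.FluxTY

open Literature.MathematicalPhysics.QuantumFieldTheory Literature.MathematicalPhysics.QuantumFieldTheory.TomboulisYaffe
open WilsonRP WilsonSiteRP Literature.RepresentationTheory.CompactGroups

variable {d L N M : ℕ} [NeZero d] [NeZero L] {G : Type*} [Group G] [TopologicalSpace G]
  [IsTopologicalGroup G] [CompactSpace G] [MeasurableSpace G] [BorelSpace G]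
  (ρ : G →* Matrix (Fin N) (Fin N) ℂ) (π : G →* Matrix (Fin M) (Fin M) ℂ)

/-! ## Plumbing (copies of part 1's private helpers) -/

section Plumbing

omit [NeZero d] [NeZero L] [MeasurableSpace G] [BorelSpace G] in
/-- `‖tr ρ(g)‖ ≤ N` for a continuous `N`-dimensional representation of a compact group. [folklore] -/
private theorem norm_trace_le (hπ : Continuous π) (g : G) : ‖(π g).trace‖ ≤ M := by
  rw [← CompactGroup.trace_unitarize π hπ, Matrix.trace]
  refine (norm_sum_le _ _).trans ?_
  calc ∑ k, ‖Matrix.diag (CompactGroup.unitarize π hπ g) k‖ ≤ ∑ _k : Fin M, (1 : ℝ) :=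
        Finset.sum_le_sum fun k _ => CompactGroup.norm_unitarize_apply_le_one π hπ g k k
    _ = M := by simp

omit [NeZero d] [NeZero L] in
/-- The value `n < L` of the residue `n`. [folklore] -/
private theorem val_natCast_of_lt {n : ℕ} (hn : n < L) : ((n : ℕ) : ZMod L).val = n := by
  rw [ZMod.val_natCast, Nat.mod_eq_of_lt hn]

omit [NeZero L] in
/-- Time coordinate of `x + s eⱼ` (`j ≠ 0`). [folklore] -/
private theorem apply_zero_add_single_of_ne' (x : Site d L) {j : Fin d} (hj : j ≠ 0) (s : ZMod L) :
    (x + Pi.single j s : Site d L) 0 = x 0 := by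
  simp [Pi.single_eq_of_ne hj.symm]

omit [NeZero L] in
/-- `θ'(x + c e₀) = x - c e₀` for `x` in the time slice `0`. [folklore] -/
private theorem negReflect_add_single_zero (x : Site d L) (hx : x 0 = 0) (c : ZMod L) :
    (x + Pi.single 0 c : Site d L).negReflect = x + Pi.single 0 (-c) := by
  funext k
  by_cases hk : k = 0
  · subst hk; simp [hx]
  · simp [negReflect_apply_of_ne _ hk, hk]

end Plumbing

/-! ## Doubling for the Polyakov-loop two-point function (TY App. I §B) -/

section PolyakovDoubling

/-- **Doubling the separation of two Polyakov loops** (Tomboulis–Yaffe 1985 App. I §B: "exactly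
the same procedure of successively applying various reflections that was used for Wilson loops may
be applied to the two point function (A1.5) to show that `(G_J)^{1/J}` is monotonically increasing in
`J` (for `1 ≤ J ≤ L/2`)"; here the reflection in the lattice hyperplane containing one of the two
loops). Torus form, any real `β`, `L` even: for the Polyakov loops `Πⱼ(x) = lineHolonomy U j L x`
winding in a spatial direction `j ≠ 0`, at the origin and at time `s ≤ L/2`,
`0 ≤ Re ⟨tr ρ(Πⱼ(0)) conj tr ρ(Πⱼ(2s e₀))⟩` and
`|⟨tr ρ(Πⱼ(0)) conj tr ρ(Πⱼ(s e₀))⟩|² ≤ N² · Re ⟨tr ρ(Πⱼ(0)) conj tr ρ(Πⱼ(2s e₀))⟩`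
(with normalised traces, `G_s² ≤ G_0 G_{2s} ≤ G_{2s}`). [cite: TomboulisYaffe1985, App. I §B (A1.5)] -/
theorem polyakovCorrelatorRep_normSq_le_double (hL : Even L) (hρ : Continuous ρ) (hπ : Continuous π) (β : ℝ)
    {j : Fin d} (hj : j ≠ 0) (s : ℕ) (hs : s ≤ L / 2) :
    0 ≤ (wilsonExpectation ρ β fun U : GaugeConfig d L G =>
        (π (lineHolonomy U j L 0)).trace *
          conj ((π (lineHolonomy U j L ((0 : Site d L) + Pi.single 0 (((2 * s : ℕ)) : ZMod L)))).trace)).re ∧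
    ‖wilsonExpectation ρ β fun U : GaugeConfig d L G =>
        (π (lineHolonomy U j L 0)).trace *
          conj ((π (lineHolonomy U j L ((0 : Site d L) + Pi.single 0 ((s : ℕ) : ZMod L)))).trace)‖ ^ 2 ≤
      (M : ℝ) ^ 2 * (wilsonExpectation ρ β fun U : GaugeConfig d L G =>
        (π (lineHolonomy U j L 0)).trace *
          conj ((π (lineHolonomy U j L ((0 : Site d L) + Pi.single 0 (((2 * s : ℕ)) : ZMod L)))).trace)).re := by
  haveI : Fact (1 < L) := ⟨by obtain ⟨r, hr⟩ := hL; have := NeZero.ne L; omega⟩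
  haveI := isProbabilityMeasure_wilsonMeasure (d := d) (L := L) ρ hρ β
  have hsL : s < L := by obtain ⟨r, hr⟩ := hL; have := NeZero.ne L; omega
  set xs : Site d L := (0 : Site d L) + Pi.single 0 ((s : ℕ) : ZMod L) with hxs
  set x2s : Site d L := (0 : Site d L) + Pi.single 0 (((2 * s : ℕ)) : ZMod L) with hx2s
  have hx00 : (0 : Site d L).negReflect = 0 := negReflect_of_two_mul (by simp)
  have hxsθ : xs.negReflect = (0 : Site d L) + Pi.single 0 (-((s : ℕ) : ZMod L)) :=
    negReflect_add_single_zero 0 rfl _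
  -- the two one-member families
  set F₁ : Unit → GaugeConfig d L G → ℂ := fun _ U => conj ((π (lineHolonomy U j L 0)).trace) with hF₁
  set F₂ : Unit → GaugeConfig d L G → ℂ := fun _ U => conj ((π (lineHolonomy U j L xs)).trace) with hF₂
  have hE : ∀ e : Edge d L, IsSitePosEdge e ∨ IsSharedEdge e →
      e ∈ ((sitePosEdges ∪ sharedEdges : Finset (Edge d L)) : Set (Edge d L)) := fun e he => by
    rw [Finset.coe_union, Set.mem_union, Finset.mem_coe, Finset.mem_coe, mem_sitePosEdges,
      mem_sharedEdges]
    exact he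
  have dep_space : ∀ (x : Site d L), (x 0).val ≤ L / 2 →
      DependsOn (fun U : GaugeConfig d L G => lineHolonomy U j L x)
      ((sitePosEdges ∪ sharedEdges : Finset (Edge d L)) : Set (Edge d L)) := by
    intro x hx U V hUV
    refine WilsonLoopRP.lineHolonomy_congr j L x fun s' _ => hUV _ (hE _ ?_)
    unfold IsSitePosEdge IsSharedEdge
    simp only [hj, ↓reduceIte, ne_eq, not_false_eq_true, true_and]
    rw [apply_zero_add_single_of_ne' _ hj]
    omega
  have hobs : ∀ (x : Site d L), (x 0).val ≤ L / 2 →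
      IsHalfObs (fun U : GaugeConfig d L G => conj ((π (lineHolonomy U j L x)).trace)) := by
    intro x hx
    refine ⟨Complex.continuous_conj.measurable.comp
      (WilsonLoopRP.entryMeasurable_lineHolonomy hπ j L x).measurable_trace, ⟨M, fun U => ?_⟩,
      fun U V hUV => ?_⟩
    · rw [Complex.norm_conj]; exact norm_trace_le π hπ _
    · simp only [dep_space x hx hUV]
  have h1 : ∀ k, IsHalfObs (F₁ k) := fun _ => hobs (0 : Site d L) (by simp)
  have h2 : ∀ k, IsHalfObs (F₂ k) := fun _ => hobs xs (by
    rw [hxs]; simp only [Pi.add_apply, Pi.zero_apply, Pi.single_eq_same, zero_add]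
    rw [val_natCast_of_lt hsL]; exact hs)
  -- the three Gram entries
  have h12 : siteRPForm ρ β F₁ F₂ = wilsonExpectation ρ β (fun U : GaugeConfig d L G =>
      (π (lineHolonomy U j L 0)).trace * conj ((π (lineHolonomy U j L xs)).trace)) := by
    unfold siteRPForm wilsonExpectation
    rw [Fintype.sum_unique]
    refine integral_congr_ae (ae_of_all _ fun U => ?_)
    simp only [hF₁, hF₂, Complex.conj_conj, WilsonLoopRP.lineHolonomy_negReflect_of_ne U hj, hx00]
  have h11 : (siteRPForm ρ β F₁ F₁).re ≤ (M : ℝ) ^ 2 := by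
    unfold siteRPForm
    rw [Fintype.sum_unique]
    have hb : ∀ U : GaugeConfig d L G, ‖conj (F₁ () U.negReflect) * F₁ () U‖ ≤ (M : ℝ) ^ 2 := fun U => by
      rw [norm_mul, Complex.norm_conj, hF₁, Complex.norm_conj, Complex.norm_conj, sq]
      exact mul_le_mul (norm_trace_le π hπ _) (norm_trace_le π hπ _) (norm_nonneg _) (Nat.cast_nonneg _)
    refine (Complex.re_le_norm _).trans ((norm_integral_le_of_norm_le_const (ae_of_all _ hb)).trans ?_)
    rw [probReal_univ, mul_one]
  have h22 : siteRPForm ρ β F₂ F₂ = wilsonExpectation ρ β (fun U : GaugeConfig d L G =>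
      (π (lineHolonomy U j L 0)).trace * conj ((π (lineHolonomy U j L x2s)).trace)) := by
    unfold siteRPForm
    rw [Fintype.sum_unique, ← wilsonExpectation_comp_torusConfigShift ρ β xs]
    unfold wilsonExpectation
    have hA : (0 : Site d L) + Pi.single 0 (-((s : ℕ) : ZMod L)) = 0 - xs := by
      rw [hxs]; simp [Pi.single_neg]
    have hB : x2s - xs = xs := by
      rw [hx2s, hxs, zero_add, zero_add, ← Pi.single_sub]
      congr 1
      push_cast
      ring
    refine integral_congr_ae (ae_of_all _ fun U => ?_)
    simp only [hF₂, Complex.conj_conj, WilsonLoopRP.lineHolonomy_negReflect_of_ne U hj, hxsθ,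
      Function.comp_apply, WilsonLoopRP.lineHolonomy_torusConfigShift, hA, hB]
  have hpos := siteRPForm_self_nonneg ρ hL hρ β h2
  have hCS := normSq_siteRPForm_le ρ hL hρ β h1 h2
  rw [h12] at hCS
  rw [h22] at hCS hpos
  refine ⟨(Complex.nonneg_iff.1 hpos).1, hCS.trans ?_⟩
  exact mul_le_mul_of_nonneg_right h11 (Complex.nonneg_iff.1 hpos).1

end PolyakovDoubling

/-! ## Swapping the axes -/

section Swap

omit [NeZero d] [NeZero L] [TopologicalSpace G] [IsTopologicalGroup G] [CompactSpace G]
  [BorelSpace G] in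
/-- Straight lines of the axis-permuted configuration. [folklore] -/
private theorem lineHolonomy_configPerm (τ : Equiv.Perm (Fin d)) (U : GaugeConfig d L G) (k : Fin d) :
    ∀ (n : ℕ) (y : Site d L),
      lineHolonomy (configPerm τ U) k n y = lineHolonomy U (τ.symm k) n (sitePerm τ.symm y)
  | 0, y => by simp [lineHolonomy]
  | n + 1, y => by
    rw [lineHolonomy, lineHolonomy, lineHolonomy_configPerm τ U k n, configPerm_apply, sitePerm_shift]

/-- **Polyakov-loop correlators under the exchange of two axes** (coordinate-permutation symmetry
of the torus Wilson state, `wilsonExpectation_comp_configPerm`): the correlator of two Polyakov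
loops in the time direction `0` separated by `w` steps in a spatial direction `j` equals the
correlator of two Polyakov loops in direction `j` separated by `w` steps in time. This lets both
halves of the Tomboulis–Yaffe chain (App. I §A–§B use reflections in time-like hyperplanes, §C in
space-like ones) be carried out with the tree's time reflection. [cite: TomboulisYaffe1985, App. I §B–§C] -/
theorem polyakovCorrelatorRep_swap (hρ : Continuous ρ) (β : ℝ) (j : Fin d) (w : ℕ) :
    wilsonExpectation ρ β (fun U : GaugeConfig d L G =>
        (π (lineHolonomy U 0 L 0)).trace *
          conj ((π (lineHolonomy U 0 L ((0 : Site d L) + Pi.single j (w : ZMod L)))).trace)) =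
      wilsonExpectation ρ β (fun U : GaugeConfig d L G =>
        (π (lineHolonomy U j L 0)).trace *
          conj ((π (lineHolonomy U j L ((0 : Site d L) + Pi.single 0 (w : ZMod L)))).trace)) := by
  have h0 : sitePerm (Equiv.swap (0 : Fin d) j) (0 : Site d L) = 0 := by
    funext k; simp [sitePerm_apply]
  conv_rhs => rw [← wilsonExpectation_comp_configPerm ρ hρ β (Equiv.swap 0 j)]
  congr 1
  funext U
  simp only [Function.comp_apply, lineHolonomy_configPerm, Equiv.symm_swap, Equiv.swap_apply_right,
    sitePerm_add, sitePerm_single, Equiv.swap_apply_left, h0]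

end Swap

end Summit.QuantumFields.YangMills.Cruxes.IR.TensionRatio.FluxTY

end
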